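import Summits.Ventures.CertifiedArithmetic.Expansions.Orient2dStageCBounds
import Mathlib.Tactic.Linarith
import Mathlib.Tactic.Positivity
import Mathlib.Tactic.Ring
import Mathlib.Tactic.NormNum

/-!
# INCIRCLE, stage C, part 2: the computed lift, the summed correction and the Taylor remainder

Shared numerical engines serving client cells; rigour lives in the verifiers; every published number
belongs to a client cell's ledger, not to the engines group. NEW WORK in the sense of this
development, continuing part 1 (`IncircleStageCTerms`, not imported: the two files are independent;
its setting, notation and caveats apply verbatim — the algorithm and the constants are Shewchuk's,
the error analysis in the standard model over `ℚ` is ours, and nothing is claimed about the C code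
`predicates.c`, which we transcribe as hypotheses between named rationals).

THE RESULTS (`0 ≤ ε`; for one cyclic term: `x, y` the computed differences of its point with tails
`xt, yt` (`|xt| ≤ ε|x|`), `ℓ = x² + y²` their exact lift, `L` the COMPUTED lift `(x ⊗ x) ⊕ (y ⊗
y)`, `x₁y₁ − x₂y₂` the minor with tails `x₁t, …` and stage-A products `P = x₁ ⊗ y₁`, `Q = x₂ ⊗
y₂`, `A = |P| + |Q|`; `C₁ = x₁y₁t + y₁x₁t − x₂y₂t − y₂x₂t`, `G = x·xt + y·yt` and `L_z = ℓ·C₁ +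
2G·(x₁y₁ − x₂y₂)` the exact first-order term):
* `sumSq_sub_lift_le` — `|ℓ − L| ≤ (2ε + ε²)L` from the three roundings of the lift (the companion
  of `sumSq_le_of_rel` of `IncircleStageBBounds`: `ℓ ≤ (1 + ε)²L`);
* `roundedSum3_sub_le` — the two roundings of the three-term sum `c = (t_a ⊕ t_b) ⊕ t_c`, for
  arbitrary per-term coefficients: from `|t_z − L_z| ≤ e·S_z`, `|t_z| ≤ M·S_z` it follows that
  `|c − (L_a + L_b + L_c)| ≤ (e + (2ε + ε²)M)·Π` and `|c| ≤ (1 + ε)²M·Π`, `Π = S_a + S_b + S_c`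
  (with the coefficients of `incircleCTerm_sub_le` of part 1: `34ε² + 144ε³ + 304ε⁴ + 408ε⁵ +
  368ε⁶ + 224ε⁷ + 88ε⁸ + 20ε⁹ + 2ε¹⁰`);
* `incircleCRemainder_le` — the second- to fourth-order Taylor remainder of one cyclic term:
  `|((x + xt)² + (y + yt)²)((x₁ + x₁t)(y₁ + y₁t) − (x₂ + x₂t)(y₂ + y₂t)) − ℓ(x₁y₁ − x₂y₂) − L_z|
  ≤ (6ε² + 4ε³ + ε⁴)(1 + ε)·ΛA` for any `Λ ≥ ℓ` (part 3 takes `Λ = (1 + ε)²L`).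
Part 3, `IncircleStageCBounds`, assembles parts 1 and 2 into the soundness of the stage-C sign
test; part 4, `IncircleStageCMargins`, evaluates the margins.

Evidence gathered before typing (engines; not part of the verification): in the exact rational model
(round-half-even to `p` bits, `p ∈ {4, 5, 8}`, error-free TWO-PRODUCT / TWO-DIFF, 600 cocircular,
one-ulp-perturbed or random quadruples per precision, of which 347 / 381 / 192 have a nonzero tail)
each inequality held in every trial; the worst observed values were `1.7ε·L` for the lift (proved
`2ε + ε²`), `2.1ε²·Π'` for the sum against `L_a + L_b + L_c` (`34ε²`, `Π' = Σ L_z·A_z`) and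
`2.7ε²·Π'` for the total remainder (`6ε²·(1 + ε)³`). References: J. R. Shewchuk, Discrete Comput.
Geom. 18 (1997) 305–363, §4.4 and Table 5; `predicates.c` (`incircleadapt`) [Shewchuk1997].
-/

namespace Summit.Ventures.CertifiedArithmetic.Expansions

/-! ## Rounding bookkeeping (private copies of the two helpers of part 1) -/

/-- One rounding step: from the standard-model fact `|a − r| ≤ u|a|` and a magnitude bound
`|a| ≤ M`, the absolute error `uM` and the magnitude `(1 + u)M` of the rounded result. -/
private theorem rnd_step {u a r M : ℚ} (hu : 0 ≤ u) (h : |a - r| ≤ u * |a|) (hM : |a| ≤ M) :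
    |a - r| ≤ u * M ∧ |r| ≤ (1 + u) * M := by
  have h1 := h.trans (mul_le_mul_of_nonneg_left hM hu)
  have h2 : |r| - |a| ≤ |r - a| := abs_sub_abs_le_abs_sub r a
  rw [abs_sub_comm] at h2
  exact ⟨h1, by linarith⟩

/-- A product with a tail, the magnitude folded in: `|t| ≤ u|y|` and `|x·y| ≤ N` give
`|x·t| ≤ uN`. -/
private theorem tail_mul_le {u x y t N : ℚ} (hu : 0 ≤ u) (h : |t| ≤ u * |y|)
    (hN : |x * y| ≤ N) : |x * t| ≤ u * N := by
  rw [abs_mul] at hN ⊢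
  calc |x| * |t| ≤ |x| * (u * |y|) := mul_le_mul_of_nonneg_left h (abs_nonneg x)
    _ = u * (|x| * |y|) := by ring
    _ ≤ u * N := mul_le_mul_of_nonneg_left hN hu

/-! ## The computed lift -/

/-- **The exact lift of the computed differences against the COMPUTED lift**: with computed squares
`x_i² = S_i ± εS_i` (`S_i ≥ 0`) and computed lift `S₁ + S₂ = L ± εL` (`L ≥ 0`),
`|(x₁² + x₂²) − L| ≤ (2ε + ε²)L` (the companion of `sumSq_le_of_rel`: `x₁² + x₂² ≤ (1 + ε)²L`). -/
theorem sumSq_sub_lift_le {u x₁ x₂ S₁ S₂ L : ℚ} (hu : 0 ≤ u) (hS₁ : |x₁ * x₁ - S₁| ≤ u * |S₁|)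
    (hS₂ : |x₂ * x₂ - S₂| ≤ u * |S₂|) (hS₁0 : 0 ≤ S₁) (hS₂0 : 0 ≤ S₂)
    (hL : |(S₁ + S₂) - L| ≤ u * |L|) (hL0 : 0 ≤ L) :
    |(x₁ * x₁ + x₂ * x₂) - L| ≤ (2 * u + u ^ 2) * L := by
  rw [abs_of_nonneg hS₁0] at hS₁
  rw [abs_of_nonneg hS₂0] at hS₂
  rw [abs_of_nonneg hL0] at hL
  have hsum : S₁ + S₂ ≤ (1 + u) * L := by linarith [(abs_sub_le_iff.mp hL).1]
  have hdec : (x₁ * x₁ + x₂ * x₂) - L = (x₁ * x₁ - S₁) + (x₂ * x₂ - S₂) + ((S₁ + S₂) - L) := by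
    ring
  rw [hdec]
  have a := abs_add_three (x₁ * x₁ - S₁) (x₂ * x₂ - S₂) ((S₁ + S₂) - L)
  have k := mul_le_mul_of_nonneg_left hsum hu
  linarith

/-! ## The three terms summed -/

/-- **Three terms summed with two roundings**, `c = (t_a ⊕ t_b) ⊕ t_c`, for arbitrary per-term
error and magnitude coefficients: if `|t_z − L_z| ≤ e·S_z` and `|t_z| ≤ M·S_z` for the three
terms then `|c − (L_a + L_b + L_c)| ≤ (e + (2ε + ε²)M)·Π` and `|c| ≤ (1 + ε)²M·Π`,
`Π = S_a + S_b + S_c`. -/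
theorem roundedSum3_sub_le {u e M ta tb tc La Lb Lc Sa Sb Sc c₁ c : ℚ} (hu : 0 ≤ u)
    (ea : |ta - La| ≤ e * Sa) (ma : |ta| ≤ M * Sa) (eb : |tb - Lb| ≤ e * Sb)
    (mb : |tb| ≤ M * Sb) (ec : |tc - Lc| ≤ e * Sc) (mc : |tc| ≤ M * Sc)
    (hc₁ : |(ta + tb) - c₁| ≤ u * |ta + tb|) (hc : |(c₁ + tc) - c| ≤ u * |c₁ + tc|) :
    |c - (La + Lb + Lc)| ≤ (e + (2 * u + u ^ 2) * M) * (Sa + Sb + Sc) ∧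
      |c| ≤ (1 + u) ^ 2 * M * (Sa + Sb + Sc) := by
  have b₁ : |ta + tb| ≤ M * Sa + M * Sb := by linarith [abs_add_le ta tb]
  obtain ⟨e₁, m₁⟩ := rnd_step hu hc₁ b₁
  have b₂ : |c₁ + tc| ≤ (1 + u) * (M * Sa + M * Sb) + M * Sc := by linarith [abs_add_le c₁ tc]
  obtain ⟨e₂, m₂⟩ := rnd_step hu hc b₂
  have x₁ : 0 ≤ u * (M * Sc) := mul_nonneg hu ((abs_nonneg tc).trans mc)
  have x₂ : 0 ≤ u * (u * (M * Sc)) := mul_nonneg hu x₁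
  constructor
  · have key : c - (La + Lb + Lc)
        = -((c₁ + tc) - c) - ((ta + tb) - c₁) + (ta - La) + (tb - Lb) + (tc - Lc) := by ring
    rw [key]
    have a1 := abs_add_le (-((c₁ + tc) - c) - ((ta + tb) - c₁) + (ta - La) + (tb - Lb)) (tc - Lc)
    have a2 := abs_add_le (-((c₁ + tc) - c) - ((ta + tb) - c₁) + (ta - La)) (tb - Lb)
    have a3 := abs_add_le (-((c₁ + tc) - c) - ((ta + tb) - c₁)) (ta - La)
    have a4 := abs_sub (-((c₁ + tc) - c)) ((ta + tb) - c₁)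
    rw [abs_neg] at a4
    linarith
  · linarith

/-! ## The higher-order remainder -/

/-- **The remainder of one cyclic term**: the true term
`((x + xt)² + (y + yt)²)((x₁ + x₁t)(y₁ + y₁t) − (x₂ + x₂t)(y₂ + y₂t))` minus its zeroth-order part
`(x² + y²)(x₁y₁ − x₂y₂)` minus its first-order part `L_z` is at most
`(6ε² + 4ε³ + ε⁴)(1 + ε)·Λ(|P| + |Q|)` for any `Λ ≥ x² + y²`. -/
theorem incircleCRemainder_le {u x xt y yt Λ x₁ x₁t y₁ y₁t x₂ x₂t y₂ y₂t P Q : ℚ} (hu : 0 ≤ u)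
    (hxt : |xt| ≤ u * |x|) (hyt : |yt| ≤ u * |y|) (hΛ : x * x + y * y ≤ Λ)
    (hx₁t : |x₁t| ≤ u * |x₁|) (hy₁t : |y₁t| ≤ u * |y₁|)
    (hx₂t : |x₂t| ≤ u * |x₂|) (hy₂t : |y₂t| ≤ u * |y₂|)
    (hP : |x₁ * y₁ - P| ≤ u * |P|) (hQ : |x₂ * y₂ - Q| ≤ u * |Q|) :
    |((x + xt) * (x + xt) + (y + yt) * (y + yt))
          * ((x₁ + x₁t) * (y₁ + y₁t) - (x₂ + x₂t) * (y₂ + y₂t))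
        - (x * x + y * y) * (x₁ * y₁ - x₂ * y₂)
        - ((x * x + y * y) * ((x₁ * y₁t + y₁ * x₁t) - (x₂ * y₂t + y₂ * x₂t))
          + 2 * (x * xt + y * yt) * (x₁ * y₁ - x₂ * y₂))|
      ≤ (6 * u ^ 2 + 4 * u ^ 3 + u ^ 4) * (1 + u) * (Λ * (|P| + |Q|)) := by
  have hP' : |x₁ * y₁| ≤ (1 + u) * |P| := by linarith [abs_sub_abs_le_abs_sub (x₁ * y₁) P]
  have hQ' : |x₂ * y₂| ≤ (1 + u) * |Q| := by linarith [abs_sub_abs_le_abs_sub (x₂ * y₂) Q]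
  have hℓ0 : 0 ≤ x * x + y * y := add_nonneg (mul_self_nonneg x) (mul_self_nonneg y)
  have key : ((x + xt) * (x + xt) + (y + yt) * (y + yt))
          * ((x₁ + x₁t) * (y₁ + y₁t) - (x₂ + x₂t) * (y₂ + y₂t))
        - (x * x + y * y) * (x₁ * y₁ - x₂ * y₂)
        - ((x * x + y * y) * ((x₁ * y₁t + y₁ * x₁t) - (x₂ * y₂t + y₂ * x₂t))
          + 2 * (x * xt + y * yt) * (x₁ * y₁ - x₂ * y₂))
      = (x * x + y * y) * (x₁t * y₁t - x₂t * y₂t)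
        + 2 * (x * xt + y * yt) * (((x₁ * y₁t + y₁ * x₁t) - (x₂ * y₂t + y₂ * x₂t))
          + (x₁t * y₁t - x₂t * y₂t))
        + (xt * xt + yt * yt) * ((x₁ * y₁ - x₂ * y₂)
          + ((x₁ * y₁t + y₁ * x₁t) - (x₂ * y₂t + y₂ * x₂t)) + (x₁t * y₁t - x₂t * y₂t)) := by
    ring
  -- products of tails
  have tt₁ : |x₁t * y₁t| ≤ u ^ 2 * |x₁ * y₁| := by
    rw [abs_mul, abs_mul]
    calc |x₁t| * |y₁t| ≤ (u * |x₁|) * (u * |y₁|) :=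
          mul_le_mul hx₁t hy₁t (abs_nonneg _) (by positivity)
      _ = u ^ 2 * (|x₁| * |y₁|) := by ring
  have tt₂ : |x₂t * y₂t| ≤ u ^ 2 * |x₂ * y₂| := by
    rw [abs_mul, abs_mul]
    calc |x₂t| * |y₂t| ≤ (u * |x₂|) * (u * |y₂|) :=
          mul_le_mul hx₂t hy₂t (abs_nonneg _) (by positivity)
      _ = u ^ 2 * (|x₂| * |y₂|) := by ring
  have f₁ : |x₁ * y₁t| ≤ u * |x₁ * y₁| := tail_mul_le hu hy₁t le_rfl
  have f₂ : |y₁ * x₁t| ≤ u * |x₁ * y₁| := tail_mul_le hu hx₁t (by rw [mul_comm y₁ x₁])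
  have f₃ : |x₂ * y₂t| ≤ u * |x₂ * y₂| := tail_mul_le hu hy₂t le_rfl
  have f₄ : |y₂ * x₂t| ≤ u * |x₂ * y₂| := tail_mul_le hu hx₂t (by rw [mul_comm y₂ x₂])
  have gx : |x * xt| ≤ u * (x * x) := tail_mul_le hu hxt (le_of_eq (abs_mul_self x))
  have gy : |y * yt| ≤ u * (y * y) := tail_mul_le hu hyt (le_of_eq (abs_mul_self y))
  have kx : xt * xt ≤ u ^ 2 * (x * x) := by
    have h := mul_le_mul hxt hxt (abs_nonneg xt) (by positivity)
    rw [abs_mul_abs_self] at h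
    calc xt * xt ≤ (u * |x|) * (u * |x|) := h
      _ = u ^ 2 * (|x| * |x|) := by ring
      _ = u ^ 2 * (x * x) := by rw [abs_mul_abs_self]
  have ky : yt * yt ≤ u ^ 2 * (y * y) := by
    have h := mul_le_mul hyt hyt (abs_nonneg yt) (by positivity)
    rw [abs_mul_abs_self] at h
    calc yt * yt ≤ (u * |y|) * (u * |y|) := h
      _ = u ^ 2 * (|y| * |y|) := by ring
      _ = u ^ 2 * (y * y) := by rw [abs_mul_abs_self]
  have hK0 : 0 ≤ xt * xt + yt * yt := add_nonneg (mul_self_nonneg xt) (mul_self_nonneg yt)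
  -- the three exact factors
  have i₀ : |x₁ * y₁ - x₂ * y₂| ≤ |x₁ * y₁| + |x₂ * y₂| := abs_sub _ _
  have i₁ : |(x₁ * y₁t + y₁ * x₁t) - (x₂ * y₂t + y₂ * x₂t)| ≤ 2 * u * (|x₁ * y₁| + |x₂ * y₂|) := by
    have a1 := abs_sub (x₁ * y₁t + y₁ * x₁t) (x₂ * y₂t + y₂ * x₂t)
    have a2 := abs_add_le (x₁ * y₁t) (y₁ * x₁t)
    have a3 := abs_add_le (x₂ * y₂t) (y₂ * x₂t)
    linarith
  have i₂ : |x₁t * y₁t - x₂t * y₂t| ≤ u ^ 2 * (|x₁ * y₁| + |x₂ * y₂|) := by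
    linarith [abs_sub (x₁t * y₁t) (x₂t * y₂t)]
  have j₁ : |(x * x + y * y) * (x₁t * y₁t - x₂t * y₂t)|
      ≤ (x * x + y * y) * (u ^ 2 * (|x₁ * y₁| + |x₂ * y₂|)) := by
    rw [abs_mul, abs_of_nonneg hℓ0]; exact mul_le_mul_of_nonneg_left i₂ hℓ0
  have j₂ : |2 * (x * xt + y * yt) * (((x₁ * y₁t + y₁ * x₁t) - (x₂ * y₂t + y₂ * x₂t))
        + (x₁t * y₁t - x₂t * y₂t))|
      ≤ (2 * (u * (x * x + y * y))) * ((2 * u + u ^ 2) * (|x₁ * y₁| + |x₂ * y₂|)) := by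
    rw [abs_mul, abs_mul, abs_two]
    refine mul_le_mul (by linarith [abs_add_le (x * xt) (y * yt)]) ?_ (abs_nonneg _)
      (by positivity)
    linarith [abs_add_le ((x₁ * y₁t + y₁ * x₁t) - (x₂ * y₂t + y₂ * x₂t))
      (x₁t * y₁t - x₂t * y₂t)]
  have j₃ : |(xt * xt + yt * yt) * ((x₁ * y₁ - x₂ * y₂)
        + ((x₁ * y₁t + y₁ * x₁t) - (x₂ * y₂t + y₂ * x₂t)) + (x₁t * y₁t - x₂t * y₂t))|
      ≤ (u ^ 2 * (x * x + y * y)) * ((1 + 2 * u + u ^ 2) * (|x₁ * y₁| + |x₂ * y₂|)) := by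
    rw [abs_mul, abs_of_nonneg hK0]
    refine mul_le_mul (by linarith) ?_ (abs_nonneg _) (by positivity)
    linarith [abs_add_three (x₁ * y₁ - x₂ * y₂)
      ((x₁ * y₁t + y₁ * x₁t) - (x₂ * y₂t + y₂ * x₂t)) (x₁t * y₁t - x₂t * y₂t)]
  rw [key]
  have a := abs_add_three ((x * x + y * y) * (x₁t * y₁t - x₂t * y₂t))
    (2 * (x * xt + y * yt) * (((x₁ * y₁t + y₁ * x₁t) - (x₂ * y₂t + y₂ * x₂t))
      + (x₁t * y₁t - x₂t * y₂t)))
    ((xt * xt + yt * yt) * ((x₁ * y₁ - x₂ * y₂)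
      + ((x₁ * y₁t + y₁ * x₁t) - (x₂ * y₂t + y₂ * x₂t)) + (x₁t * y₁t - x₂t * y₂t)))
  have k₁ : (x * x + y * y) * |x₁ * y₁| ≤ (x * x + y * y) * ((1 + u) * |P|) :=
    mul_le_mul_of_nonneg_left hP' hℓ0
  have k₂ : (x * x + y * y) * |x₂ * y₂| ≤ (x * x + y * y) * ((1 + u) * |Q|) :=
    mul_le_mul_of_nonneg_left hQ' hℓ0
  have c₀ : 0 ≤ 6 * u ^ 2 + 4 * u ^ 3 + u ^ 4 := by positivity
  have k₃ := mul_le_mul_of_nonneg_left (add_le_add k₁ k₂) c₀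
  have c₁ : 0 ≤ (6 * u ^ 2 + 4 * u ^ 3 + u ^ 4) * (1 + u) * (|P| + |Q|) := by positivity
  have k₄ := mul_le_mul_of_nonneg_right hΛ c₁
  linarith

end Summit.Ventures.CertifiedArithmetic.Expansions
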